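import Summits.SmoothPoincare4.SmoothPoincare4.Theorems.CongruenceShadowsGriffithsHandlebodyExtensionCoverPlanarF
import HarnessLib

/-!
# SmoothPoincare4 / CongruenceShadows — `GriffithsHandlebodyExtension` (item stmt-SmoothPoincare4-15190): the planar family (E3), C.3 — the periodic branch family

Support file (`--supports` stmt-SmoothPoincare4-15190) of the homothety-cover proof of the genus-one
clause (E) of Griffiths' handlebody extension theorem — *every self-diffeomorphism of the Heegaard torus
`∂V` of the round solid torus fixing the base point and acting trivially on `π₁(∂V)` extends to a
self-diffeomorphism of `V`* (hypothesis `hE` of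
`Literature.Topology.FourManifolds.RoundSolidTorusModel.diffeoExtends_of_map_ker_eq_ker_of_forall_diffeoExtends`).
See the module docstring of `…CoverDefs` for the whole line (E1–E6) and the notation
(`τ̂`, `δ_λ`, `ρ`, `χ`, `f`, `Δ^(c)`, `α`, `L`, `M`, `Ψ̂`, `ẽ_c`).

This part (E3-C, last third, i): the branch family `E_t = Φ_t ∘ e₀ ∘ k_t`: jointly smooth, injective with smooth
inverse at image points, PERIODIC (`E_{t+1} = E_t` on `‖z‖ < 1 + η/2`, `t ∈ (-1/4, 1/4)`), equal to `S_t` on the unit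
circle and mapping the closed unit disc onto `{‖τ' (λ^t w)‖ ≤ λ^t}`; the log-coordinate `t(c)` and branch index.
-/

-- the registered namespace `Summit.SmoothPoincare4.SmoothPoincare4.Theorems` repeats a component
set_option linter.dupNamespace false

noncomputable section

namespace Summit.SmoothPoincare4.SmoothPoincare4.Theorems

namespace HomothetyCover

open Set Function Metric Filter
open scoped Topology ContDiff

namespace Planar

open Set Function Metric Filter
open scoped Topology ContDiff Manifold
open Literature.Topology.FourManifolds
attribute [local instance] factFinrankE2
variable {lam : ℝ} (P : PI lam)

section Branch

variable {lam : ℝ} {P : PI lam} {D : PI.CD P}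

namespace PI.CD

namespace KD

variable (Q : D.KD)

/-- The branch family `E_t z = Φ_t (e₀ (k_t z))`. -/
def Ebr (t : ℝ) (z : E2) : E2 := D.Φ t (D.e₀ (Q.k t z))

/-- Its inverse `E'_t w = k_t⁻¹ (e₀⁻¹ (Φ_t⁻¹ w))` (a left inverse; `e₀⁻¹` is only a left inverse). -/
def Ebr' (t : ℝ) (w : E2) : E2 := Q.k' t (D.e₀' (D.Φ' t w))

/-- `E'_t ∘ E_t = id`. -/
theorem Ebr'_Ebr (t : ℝ) (z : E2) : Q.Ebr' t (Q.Ebr t z) = z := by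
  simp [Ebr, Ebr', D.Φ'Φ, D.e₀'e₀, Q.k'_k]

/-- Each branch stage `E_t` is injective. -/
theorem Ebr_injective (t : ℝ) : Injective (Q.Ebr t) := fun a b h => by
  have := congrArg (Q.Ebr' t) h; rwa [Q.Ebr'_Ebr, Q.Ebr'_Ebr] at this

/-- `(t, z) ↦ E_t z` is smooth. -/
theorem contDiff_Ebr : ContDiff ℝ ∞ (uncurry Q.Ebr) := by
  have h1 : ContDiff ℝ ∞ (fun q : ℝ × E2 => D.e₀ (Q.k q.1 q.2)) := D.he₀.comp Q.contDiff_k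
  exact D.hΦ.comp (contDiff_fst.prodMk h1)

/-- `E'` is smooth at the image points `(t, E_t z)`. -/
theorem contDiffAt_Ebr' (t : ℝ) (z : E2) : ContDiffAt ℝ ∞ (uncurry Q.Ebr') (t, Q.Ebr t z) := by
  have h1 : ContDiffAt ℝ ∞ (fun q : ℝ × E2 => D.Φ' q.1 q.2) (t, Q.Ebr t z) := D.hΦ'.contDiffAt
  have hval : (fun q : ℝ × E2 => D.Φ' q.1 q.2) (t, Q.Ebr t z) = D.e₀ (Q.k t z) := by
    show D.Φ' t (Q.Ebr t z) = _; rw [Ebr, D.Φ'Φ]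
  have h2 := (D.he₀' (Q.k t z)).comp_contDiffWithinAt_of_eq (t, Q.Ebr t z)
    (h1.contDiffWithinAt (s := Set.univ)) hval
  rw [contDiffWithinAt_univ] at h2
  -- h2 : ContDiffAt (e₀' ∘ fun q => Φ' q.1 q.2) (t, Ebr t z)
  have h3 : ContDiffAt ℝ ∞ (fun q : ℝ × E2 => (q.1, (D.e₀' ∘ fun q : ℝ × E2 => D.Φ' q.1 q.2) q))
      (t, Q.Ebr t z) := contDiffAt_fst.prodMk h2
  exact Q.contDiff_k'.contDiffAt.comp _ h3

/-- **Periodicity of the branch family** on the slightly enlarged disc. -/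
theorem Ebr_add_one (hlam : 1 < lam) {t : ℝ} (ht : t ∈ Ioo (-(1 / 4) : ℝ) (1 / 4)) {z : E2}
    (hz : ‖z‖ < 1 + D.η / 2) : Q.Ebr (t + 1) z = Q.Ebr t z := by
  have hl : 0 < lam := lt_trans zero_lt_one hlam
  have hk0 : Q.k t z = z := Q.k_of_le ht.2.le z
  have hk1 : Q.k (t + 1) z = D.H (t + 1) z := Q.k_of_ge (by linarith [ht.1]) z
  have hcl : tclamp (t + 1) = t + 1 := tclamp_of_mem ⟨by linarith [ht.1], by linarith [ht.2]⟩
  rw [Ebr, Ebr, hk0, hk1]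
  by_cases hz1 : ‖z‖ < 1
  · obtain ⟨x, -, hxe⟩ := D.exists_hmap_e₀ hlam (t + 1) hz1
    rw [PI.CD.H, if_pos hz1, hxe, D.e₀'e₀, ← hxe, hcl, PI.CD.hmap, add_sub_cancel_right, D.ΦΦ']
  · have hz1' : 1 - D.η < ‖z‖ := by linarith [D.η_pos, not_lt.1 hz1]
    rw [D.H_eq_self hlam (t + 1) hz1']
    have hc : |‖z‖ - 1| < D.η := by rw [abs_lt]; constructor <;> linarith [D.η_pos]
    have hmem : P.τ' (D.e₀ z) ∈ ann := annInt_subset_ann (D.collar z hc)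
    have := D.Φ_add_one_τ hl (t := t) ⟨by linarith [ht.1], by linarith [ht.2]⟩ hmem
    rwa [P.τ_τ'] at this

/-- Iterated periodicity `E_{t+n} = E_t` while all intermediate times stay in the window `(-1/4, 1/4)`. -/
theorem Ebr_add_int (hlam : 1 < lam) :
    ∀ (n : ℕ) {t : ℝ}, (∀ j : ℕ, j < n → t + j ∈ Ioo (-(1 / 4) : ℝ) (1 / 4)) →
      ∀ {z : E2}, ‖z‖ < 1 + D.η / 2 → Q.Ebr (t + n) z = Q.Ebr t z := by
  intro n
  induction n with
  | zero => intro t _ z _; simp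
  | succ n ih =>
    intro t ht z hz
    rw [Nat.cast_succ, ← add_assoc, Q.Ebr_add_one hlam (ht n (Nat.lt_succ_self n)) hz]
    exact ih (fun j hj => ht j (Nat.lt_succ_of_lt hj)) hz

/-- On the unit circle `E_t = Φ_t ∘ τ = S_t`. -/
theorem Ebr_sphere {t : ℝ} (ht : t ∈ Ioo (-1 : ℝ) 2) {u : E2} (hu : ‖u‖ = 1) : Q.Ebr t u = P.S t u := by
  have hk : Q.k t u = u := Q.k_of_norm t (by rw [hu]; linarith [D.η_pos])
  rw [Ebr, hk, D.bdry u hu, D.track t ht u ⟨by rw [hu]; norm_num, by rw [hu]; norm_num⟩]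

/-- The image of the closed unit disc under a branch stage: the closed Jordan domain of the
conjugated curve, `{‖τ' (c w)‖ ≤ c}`, `c = λ^t`. -/
theorem Ebr_image_closedBall (hlam : 1 < lam) {t : ℝ} (ht : t ∈ Ioo (-1 : ℝ) 2) :
    Q.Ebr t '' closedBall (0 : E2) 1 = {w | ‖P.τ' (cexp lam t • w)‖ ≤ cexp lam t} := by
  have hl : 0 < lam := lt_trans zero_lt_one hlam
  have hτc := P.continuous_τ hlam
  have hτ'c := P.continuous_τ' hlam
  have hc0 := cexp_ne_zero (lam := lam) t
  have hcpos := cexp_pos (lam := lam) t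
  -- `Ebr t '' closedBall = Φ t '' (e₀ '' closedBall) = Φ t '' T`
  have h1 : Q.Ebr t '' closedBall (0 : E2) 1 = D.Φ t '' (D.e₀ '' closedBall 0 1) := by
    conv_rhs => rw [← Q.k_image_closedBall t]
    rw [← image_comp, ← image_comp]; rfl
  rw [h1, D.img_closedBall, ← P.image_τ_closedBall, ← image_comp]
  -- conjugation: `ψ = S'_t ∘ Φ_t ∘ τ` fixes the annulus
  set ψ : E2 → E2 := fun x => P.S' t (D.Φ t (P.τ x)) with hψ
  set ψ' : E2 → E2 := fun x => P.τ' (D.Φ' t (P.S t x)) with hψ'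
  have hSc : Continuous (P.S t) := by
    show Continuous fun u : E2 => (cexp lam t)⁻¹ • P.τ (cexp lam t • u)
    exact (hτc.comp (continuous_id.const_smul (cexp lam t))).const_smul ((cexp lam t)⁻¹)
  have hS'c : Continuous (P.S' t) := by
    show Continuous fun u : E2 => (cexp lam t)⁻¹ • P.τ' (cexp lam t • u)
    exact (hτ'c.comp (continuous_id.const_smul (cexp lam t))).const_smul ((cexp lam t)⁻¹)
  have hΦc : Continuous (D.Φ t) := D.hΦ.continuous.comp (continuous_const.prodMk continuous_id)
  have hΦ'c : Continuous (D.Φ' t) := D.hΦ'.continuous.comp (continuous_const.prodMk continuous_id)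
  have hψc : Continuous ψ := hS'c.comp (hΦc.comp hτc)
  have hψ'c : Continuous ψ' := hτ'c.comp (hΦ'c.comp hSc)
  have i1 : ∀ x, ψ' (ψ x) = x := fun x => by simp [hψ, hψ', P.S_S', D.Φ'Φ, P.τ'_τ]
  have i2 : ∀ x, ψ (ψ' x) = x := fun x => by simp [hψ, hψ', P.τ_τ', D.ΦΦ', P.S'_S]
  have hfix : ∀ u ∈ ann, ψ u = u := fun u hu => by simp [hψ, D.track t ht u hu, P.S'_S]
  have key := image_closedBall_of_fix_ann hψc hψ'c i1 i2 hfix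
  have hcomp : D.Φ t ∘ P.τ = P.S t ∘ ψ := by funext x; simp [hψ, P.S_S']
  rw [hcomp, image_comp, key]
  ext w; constructor
  · rintro ⟨x, hx, rfl⟩
    show ‖P.τ' (cexp lam t • P.S t x)‖ ≤ cexp lam t
    rw [PI.S, smul_smul, mul_inv_cancel₀ hc0, one_smul, P.τ'_τ, norm_smul, Real.norm_eq_abs,
      abs_of_pos hcpos]
    rw [mem_closedBall_zero_iff] at hx
    nlinarith
  · intro hw
    refine ⟨P.S' t w, ?_, P.S_S' t w⟩
    rw [mem_closedBall_zero_iff, PI.S', norm_smul, Real.norm_eq_abs, abs_inv, abs_of_pos hcpos]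
    rw [inv_mul_le_iff₀ hcpos, mul_one]
    exact hw

end KD

end PI.CD

end Branch

/-! ### C-iv. The log-periodic global family -/

section Global

variable {lam : ℝ} {P : PI lam} {D : PI.CD P}

namespace PI

variable (lam) in
/-- Log-coordinate `t(c) = log c / log λ`, so that `λ^{t(c)} = c`. -/
def tOf (c : ℝ) : ℝ := Real.log c / Real.log lam

variable (lam) in
/-- The branch index `m(c) = ⌊t(c) + 1/8⌋`. -/
def mOf (c : ℝ) : ℤ := ⌊tOf lam c + 1 / 8⌋

variable (lam) in
/-- The branch parameter `t(c) - m(c) ∈ [-1/8, 7/8)`. -/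
def frac (c : ℝ) : ℝ := tOf lam c - mOf lam c

/-- `frac c ∈ [-1/8, 7/8)`. -/
theorem frac_mem (c : ℝ) : frac lam c ∈ Ico (-(1 / 8) : ℝ) (7 / 8) := by
  have h1 := Int.floor_le (tOf lam c + 1 / 8)
  have h2 := Int.lt_floor_add_one (tOf lam c + 1 / 8)
  simp only [frac, mOf, mem_Ico]
  constructor <;> linarith

/-- `t(λc) = t(c) + 1`. -/
theorem tOf_mul (hlam : 1 < lam) {c : ℝ} (hc : 0 < c) : tOf lam (lam * c) = tOf lam c + 1 := by
  have hl : Real.log lam ≠ 0 := (Real.log_pos hlam).ne'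
  rw [tOf, tOf, Real.log_mul (by linarith) hc.ne', add_div, div_self hl, add_comm]

/-- `m(λc) = m(c) + 1`. -/
theorem mOf_mul (hlam : 1 < lam) {c : ℝ} (hc : 0 < c) : mOf lam (lam * c) = mOf lam c + 1 := by
  rw [mOf, mOf, tOf_mul hlam hc, show tOf lam c + 1 + 1 / 8 = tOf lam c + 1 / 8 + 1 by ring,
    Int.floor_add_one]

/-- `frac (λc) = frac c`: the branch parameter is log-periodic. -/
theorem frac_mul (hlam : 1 < lam) {c : ℝ} (hc : 0 < c) : frac lam (lam * c) = frac lam c := by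
  rw [frac, frac, mOf_mul hlam hc, tOf_mul hlam hc]; push_cast; ring

/-- `λ^{t(c)} = c`. -/
theorem cexp_tOf (hlam : 1 < lam) {c : ℝ} (hc : 0 < c) : cexp lam (tOf lam c) = c := cexp_log hlam hc

/-- `t(c)` is smooth at `c > 0`. -/
theorem contDiffAt_tOf {c : ℝ} (hc : 0 < c) : ContDiffAt ℝ ∞ (tOf lam) c :=
  (Real.contDiffAt_log.2 hc.ne').div_const _

variable (P) in
/-- `S'_{t+m} = S'_t` for integer `m`. -/
theorem S'_add_int (hlam : 0 < lam) (m : ℤ) (t : ℝ) (w : E2) : P.S' (t + m) w = P.S' t w := by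
  have := P.S_add_int hlam m t (P.S' t w)
  rw [P.S_S'] at this
  calc P.S' (t + m) w = P.S' (t + m) (P.S (t + m) (P.S' t w)) := by rw [this]
    _ = P.S' t w := P.S'_S _ _

variable (P) in
/-- `‖S'_t w‖ ≤ 1 ↔ ‖τ' (λ^t w)‖ ≤ λ^t`. -/
theorem norm_S'_le_one_iff (t : ℝ) (w : E2) :
    ‖P.S' t w‖ ≤ 1 ↔ ‖P.τ' (cexp lam t • w)‖ ≤ cexp lam t := by
  have hcpos := cexp_pos (lam := lam) t
  rw [PI.S', norm_smul, Real.norm_eq_abs, abs_inv, abs_of_pos hcpos, inv_mul_le_iff₀ hcpos, mul_one]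

end PI

end Global

end Planar

end HomothetyCover

end Summit.SmoothPoincare4.SmoothPoincare4.Theorems

end
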